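import Literature.NumberTheory.EllipticCurves.PlusMinusPAdicLFunctionProofs
import Literature.NumberTheory.EllipticCurves.PAdicLFunctionIntegralityProofs
import Literature.NumberTheory.EllipticCurves.PAdicLFunctionDistributionProofs
import Literature.NumberTheory.EllipticCurves.PAdicLFunctionDistributionHoldsProofs
import Literature.NumberTheory.EllipticCurves.PAdicLFunctionProofs
import Literature.NumberTheory.EllipticCurves.ModularFormsGamma0Genus
import Literature.NumberTheory.EllipticCurves.ModularSymbolsProofs
import Mathlib.Analysis.Normed.Group.Ultra
import Literature.NumberTheory.EllipticCurves.FormalGroupDictionaryProofs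
import HarnessLib

/-!
# Route `SignedLowerHalves`, crux `KobayashiMainConjectureSmallImage` (item stmt-BirchSwinnertonDyer-19002),
# line `birth_acns`, stub `stub_muOneSign_ns_three`: PRELIMINARIES for the reduction of the one-sign μ-rider to group theory
# of `Γ₀(N)` (`…SmallImageHeckePrimeMu.lean`): Bézout matrices with prescribed `d`-entry, `2([B/D]⁺ − [0]⁺) = k_γ`,
# `p`-integrality, the Eisenstein integer `K₀ = 2(p+1)[0]⁺`, `‖[0]⁺‖ < 1` from Hecke at `r = 0`
# (cell `bsd-ssimc`, seat `bsd-line-slh-p3` gen 8; THEOREMS ONLY; helper)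

Everything here is proved from tree theorems (`modularSymbol_gamma0_smul_holds`, `cuspSymbol_mul_holds`, `plusSymbol_eq_re_holds`,
`ratCast_ratPlusSymbol_holds`, `IsNewform0.plusPeriod_pos_holds`, `realPeriods_eq_zmultiples_of_plusPeriod_ne_zero`,
`sub_mul_modularSymbol_zero_mem_periodLattice`, `norm_ratPlusSymbol_le_one`, `intCast_mul_ratPlusSymbol`); no named fact is
assumed; nothing about the crux is asserted; BSD is not proved by any of this.

References: [MazurTateTeitelbaum1986Invent] §I.4 (4.2), §I.8; [Manin1972] Prop. 1.4, Thm. 1.6; [CremonaAlgorithms1997] §2.8 (2.8.8);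
[Pollack2003] Thm. 5.6.
-/

set_option linter.dupNamespace false
set_option autoImplicit false

noncomputable section

open scoped Classical MatrixGroups ModularForm

open CongruenceSubgroup Literature.NumberTheory.EllipticCurves Literature.NumberTheory.EllipticCurves.ModularForms

namespace Summit.BirchSwinnertonDyer.BirchSwinnertonDyer.Theorems.SmallImageHeckePrimeMu

variable {N : ℕ} [NeZero N] (f : CuspForm (Gamma0 N) 2)

/-! ## §1 A Bézout matrix with prescribed lower-right entry, and Manin's relation for it -/

/-- **The cusp `B/D` (`gcd(D, BN) = 1`, `D ≠ 0`) is `γ·0` for a `γ ∈ Γ₀(N)` with lower-right entry EXACTLY `D`**, and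
Manin's relation `{∞, B/D}_f = {∞, γ∞}_f + {∞, 0}_f` (`modularSymbol_gamma0_smul_holds` at `r = 0`; the matrix is
`(u, B; −vN, D)` with `uD + vBN = 1`, as in `modularSymbol_div_sub_zero_mem_periodLattice`).
[cite: Manin1972, Prop. 1.4 and Thm. 1.6] -/
theorem exists_gamma0_apply_one_one_eq {B D : ℤ} (hD : D ≠ 0) (hcop : IsCoprime D (B * N)) :
    ∃ γ : Gamma0 N, ((γ : SL(2, ℤ)) 1 1 : ℤ) = D ∧
      modularSymbol f ((B : ℚ) / D) = cuspSymbol f γ + modularSymbol f 0 := by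
  obtain ⟨u, v, huv⟩ := hcop
  let γ : SL(2, ℤ) := ⟨!![u, B; -(v * N), D], by
    rw [Matrix.det_fin_two_of]; linear_combination huv⟩
  have hγ0 : γ ∈ Gamma0 N := by
    rw [Gamma0_mem]
    show (((-(v * N) : ℤ)) : ZMod N) = 0
    push_cast
    rw [ZMod.natCast_self, mul_zero, neg_zero]
  have hDQ : (D : ℚ) ≠ 0 := by exact_mod_cast hD
  have hne : ((γ 1 0 : ℤ) : ℚ) * 0 + ((γ 1 1 : ℤ) : ℚ) ≠ 0 := by
    rw [mul_zero, zero_add]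
    exact hDQ
  have key := modularSymbol_gamma0_smul_holds f ⟨γ, hγ0⟩ 0 hne
  have hquot : (((γ 0 0 : ℤ) : ℚ) * 0 + ((γ 0 1 : ℤ) : ℚ)) /
      (((γ 1 0 : ℤ) : ℚ) * 0 + ((γ 1 1 : ℤ) : ℚ)) = (B : ℚ) / D := by
    rw [mul_zero, zero_add, mul_zero, zero_add]
    rfl
  rw [hquot] at key
  exact ⟨⟨γ, hγ0⟩, rfl, key⟩

/-! ## §2 The rational plus symbol as a real part, and the integer `k_γ` of a period -/

/-- For a rational newform: `([x]⁺_f : ℝ) = re {∞, x}_f / Ω⁺_f` (`ratCast_ratPlusSymbol_holds`, `plusSymbol_eq_re_holds`,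
real coefficients from `coeffField f = ⊥`). [cite: MazurTateTeitelbaum1986Invent, §I.8] -/
theorem ratCast_ratPlusSymbol_eq_re_div (hf0 : IsNewform0 f) (hQ : coeffField f = ⊥) (x : ℚ) :
    (ratPlusSymbol f x : ℝ) = (modularSymbol f x).re / plusPeriod f := by
  rw [ratCast_ratPlusSymbol_holds hf0 hQ x, normalizedPlusSymbol,
    plusSymbol_eq_re_holds f (cuspCoeff_im_eq_zero_of_coeffField_eq_bot hQ) x, Complex.ofReal_re]

/-- Every period has real part in `ℤ · Ω⁺_f/2` (definition of `Ω⁺_f`, `realPeriods_eq_zmultiples_of_plusPeriod_ne_zero`).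
[cite: CremonaAlgorithms1997, §2.8] -/
theorem exists_re_cuspSymbol_eq (hf0 : IsNewform0 f) (hQ : coeffField f = ⊥) (γ : Gamma0 N) :
    ∃ k : ℤ, (cuspSymbol f γ).re = k * (plusPeriod f / 2) := by
  have hΩ : plusPeriod f ≠ 0 := (IsNewform0.plusPeriod_pos_holds hf0 hQ).ne'
  obtain ⟨hre, -⟩ := realPeriods_eq_zmultiples_of_plusPeriod_ne_zero f hΩ
  have hmem : (cuspSymbol f γ).re ∈ realPeriods f :=
    AddSubgroup.mem_map_of_mem _ (cuspSymbol_mem_periodLattice f γ)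
  rw [hre, AddSubgroup.mem_zmultiples_iff] at hmem
  obtain ⟨k, hk⟩ := hmem
  exact ⟨k, by rw [← hk, zsmul_eq_mul]⟩

/-- **`2([B/D]⁺ − [0]⁺) = k_γ`** for the Bézout matrix `γ` of §1: the symbol difference at a cusp equivalent to `0` is half
the integer coordinate of the period `re {∞, γ∞}_f = k_γ · Ω⁺_f/2`, with `d(γ) = D`.
[cite: Manin1972, Prop. 1.4] [cite: CremonaAlgorithms1997, §2.8] -/
theorem exists_gamma0_two_mul_sub_eq (hf0 : IsNewform0 f) (hQ : coeffField f = ⊥) {B D : ℤ} (hD : D ≠ 0)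
    (hcop : IsCoprime D (B * N)) :
    ∃ (γ : Gamma0 N) (k : ℤ), ((γ : SL(2, ℤ)) 1 1 : ℤ) = D ∧ (cuspSymbol f γ).re = k * (plusPeriod f / 2) ∧
      2 * (ratPlusSymbol f ((B : ℚ) / D) - ratPlusSymbol f 0) = k := by
  obtain ⟨γ, hγ, hManin⟩ := exists_gamma0_apply_one_one_eq f hD hcop
  obtain ⟨k, hk⟩ := exists_re_cuspSymbol_eq f hf0 hQ γ
  refine ⟨γ, k, hγ, hk, ?_⟩
  have hΩ : plusPeriod f ≠ 0 := (IsNewform0.plusPeriod_pos_holds hf0 hQ).ne'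
  apply Rat.cast_injective (α := ℝ)
  push_cast
  rw [ratCast_ratPlusSymbol_eq_re_div f hf0 hQ, ratCast_ratPlusSymbol_eq_re_div f hf0 hQ, hManin,
    Complex.add_re, hk]
  field_simp
  ring

/-! ## §3 Small `p`-adic lemmas -/

variable {p : ℕ} [Fact p.Prime]

omit [NeZero N] in
/-- An integer of `p`-adic norm `< 1` is divisible by `p`, i.e. vanishes in `ℤ/p`. [folklore] -/
theorem intCast_zmod_eq_zero_of_norm_lt_one {k : ℤ} (h : ‖((k : ℚ) : ℚ_[p])‖ < 1) : (k : ZMod p) = 0 := by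
  rw [Rat.cast_intCast, Padic.norm_intCast_lt_one_iff] at h
  exact (ZMod.intCast_zmod_eq_zero_iff_dvd k p).mpr h

/-! ## §4 `2([x]⁺ − [0]⁺)` from a Manin relation; `p`-integrality; the Eisenstein integer `K₀ = 2(p+1)[0]⁺` -/

/-- If `{∞, x}_f = {∞, γ∞}_f + {∞, 0}_f` and `re {∞, γ∞}_f = k · Ω⁺_f/2`, then `2([x]⁺ − [0]⁺) = k`.
[cite: MazurTateTeitelbaum1986Invent, §I.8] -/
theorem two_mul_sub_eq_of_manin (hf0 : IsNewform0 f) (hQ : coeffField f = ⊥) {γ : Gamma0 N} {x : ℚ}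
    (hManin : modularSymbol f x = cuspSymbol f γ + modularSymbol f 0) {k : ℤ}
    (hk : (cuspSymbol f γ).re = k * (plusPeriod f / 2)) :
    2 * (ratPlusSymbol f x - ratPlusSymbol f 0) = k := by
  have hΩ : plusPeriod f ≠ 0 := (IsNewform0.plusPeriod_pos_holds hf0 hQ).ne'
  apply Rat.cast_injective (α := ℝ)
  push_cast
  rw [ratCast_ratPlusSymbol_eq_re_div f hf0 hQ, ratCast_ratPlusSymbol_eq_re_div f hf0 hQ, hManin,
    Complex.add_re, hk]
  field_simp
  ring

omit [NeZero N] in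
/-- The denominator of `a/p^k` (`a ∈ ℤ`) is prime to `N` when `p ∤ N`. [folklore] -/
theorem coprime_den_intCast_div_pow (hpN : ¬ p ∣ N) (a : ℤ) (k : ℕ) :
    Nat.Coprime ((a : ℚ) / (p : ℚ) ^ k).den N := by
  have hcop : Nat.Coprime (p ^ k) N :=
    Nat.Coprime.pow_left k ((Nat.Prime.coprime_iff_not_dvd Fact.out).mpr hpN)
  have h := coprime_den_of_coprime hcop a
  have heq : ((a : ℚ)) / ((p ^ k : ℕ) : ℚ) = (a : ℚ) / (p : ℚ) ^ k := by push_cast; ring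
  rwa [heq] at h

/-- **`p`-integrality of `[a/p^k]⁺_f`** (`a ∈ ℤ`; `p` odd, `p ∤ N`, `a_p = 0`: Eisenstein number `−(p+1)`).
[cite: Pollack2003, Thm. 5.6] -/
theorem norm_ratPlusSymbol_intCast_div_pow_le_one (hp2 : p ≠ 2) (hf0 : IsNewform0 f) (hpN : ¬ p ∣ N)
    (hap : cuspCoeff f p = ((0 : ℤ) : ℂ)) (a : ℤ) (k : ℕ) :
    ‖((ratPlusSymbol f ((a : ℚ) / (p : ℚ) ^ k) : ℚ) : ℚ_[p])‖ ≤ 1 := by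
  have hp : p.Prime := Fact.out
  have h0 : (((-((p : ℤ) + 1) : ℤ) : ℂ)) * modularSymbol f 0 ∈ periodLattice f := by
    have h := sub_mul_modularSymbol_zero_mem_periodLattice hf0 hp hpN
    rw [hap] at h
    convert h using 2
    push_cast
    ring
  have hpn : ¬ (p : ℤ) ∣ -((p : ℤ) + 1) := by
    rw [dvd_neg]
    intro h
    have h1 : (p : ℤ) ∣ 1 := by
      have h2 := dvd_sub h (dvd_refl (p : ℤ))
      rwa [add_sub_cancel_left] at h2
    exact hp.ne_one (by exact_mod_cast Int.eq_one_of_dvd_one (by positivity) h1)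
  exact norm_ratPlusSymbol_le_one f hp2 hpn h0 (coprime_den_intCast_div_pow (p := p) hpN a k)

/-- **The Eisenstein integer `K₀ = 2(p+1)[0]⁺_f ∈ ℤ`** (rational newform, `p ∤ N`, `a_p = 0`): by the Hecke relation at
`r = 0`, `2[0]⁺ = −Σ_{0<j<p} [j/p]⁺`, and each `2([j/p]⁺ − [0]⁺)` is the integer coordinate of a period.
[cite: MazurTateTeitelbaum1986Invent, §I.4 (4.2)] [cite: CremonaAlgorithms1997, §2.8 (2.8.8)] -/
theorem exists_intCast_eq_two_mul_mul_ratPlusSymbol_zero (hf0 : IsNewform0 f) (hQ : coeffField f = ⊥)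
    (hpN : ¬ p ∣ N) (hap : cuspCoeff f p = ((0 : ℤ) : ℂ)) :
    ∃ K₀ : ℤ, (K₀ : ℚ) = 2 * ((p : ℚ) + 1) * ratPlusSymbol f 0 := by
  have hp : p.Prime := Fact.out
  haveI : NeZero p := ⟨hp.ne_zero⟩
  have hrat : ∀ r : ℚ, (ratPlusSymbol f r : ℝ) = normalizedPlusSymbol f r :=
    fun r ↦ ratCast_ratPlusSymbol_holds hf0 hQ r
  have hH := intCast_mul_ratPlusSymbol p hf0 hp hpN hap hrat 0
  -- each `2([j/p]⁺ − [0]⁺)`, `0 < j < p`, is an integer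
  have hj : ∀ j : Fin p, j ≠ 0 →
      ∃ k : ℤ, 2 * (ratPlusSymbol f ((0 + (j : ℚ)) / p) - ratPlusSymbol f 0) = k := by
    intro j hj0
    have hjp : ¬ p ∣ (j : ℕ) := fun h ↦ hj0 (Fin.ext (by
      rw [Fin.val_zero]
      exact Nat.eq_zero_of_dvd_of_lt h j.isLt))
    have hcop : IsCoprime (p : ℤ) (((j : ℕ) : ℤ) * N) := by
      have hnat : Nat.Coprime p ((j : ℕ) * N) :=
        Nat.Coprime.mul_right ((hp.coprime_iff_not_dvd).mpr hjp) ((hp.coprime_iff_not_dvd).mpr hpN)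
      have h := Nat.isCoprime_iff_coprime.mpr hnat
      push_cast at h
      exact h
    obtain ⟨γ, k, -, hk, h2⟩ := exists_gamma0_two_mul_sub_eq f hf0 hQ (B := ((j : ℕ) : ℤ)) (D := (p : ℤ))
      (by exact_mod_cast hp.ne_zero) hcop
    refine ⟨k, ?_⟩
    rw [← h2]
    push_cast
    ring_nf
  choose! kj hkj using hj
  refine ⟨-(∑ j ∈ (Finset.univ : Finset (Fin p)).erase 0, kj j), ?_⟩
  -- Hecke at `0`: `0 = [0]⁺ + Σ_{j≠0} [j/p]⁺ + [0]⁺`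
  rw [Int.cast_zero, zero_mul, mul_zero, ← Finset.add_sum_erase _ _ (Finset.mem_univ (0 : Fin p))] at hH
  simp only [Fin.val_zero, CharP.cast_eq_zero, add_zero, zero_div] at hH
  have hsum : ∑ j ∈ (Finset.univ : Finset (Fin p)).erase 0, ratPlusSymbol f ((0 + (j : ℚ)) / p) =
      ∑ j ∈ (Finset.univ : Finset (Fin p)).erase 0, ((kj j : ℚ) / 2 + ratPlusSymbol f 0) := by
    refine Finset.sum_congr rfl fun j hj ↦ ?_
    have h := hkj j (Finset.ne_of_mem_erase hj)
    linarith
  rw [hsum, Finset.sum_add_distrib, Finset.sum_const, Finset.card_erase_of_mem (Finset.mem_univ _),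
    Finset.card_univ, Fintype.card_fin, nsmul_eq_mul, ← Finset.sum_div] at hH
  push_cast
  have hp1 : ((p - 1 : ℕ) : ℚ) = (p : ℚ) - 1 := by
    rw [Nat.cast_sub hp.one_lt.le, Nat.cast_one]
  rw [hp1] at hH
  linarith

/-- **`‖[0]⁺_f‖_p < 1` if all `[j/p]⁺_f` (`0 < j < p`) have norm `< 1`** (Hecke at `r = 0` with `a_p = 0`:
`2[0]⁺ = −Σ_{0<j<p} [j/p]⁺`, ultrametric inequality, `p` odd). [cite: MazurTateTeitelbaum1986Invent, §I.4 (4.2)] -/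
theorem norm_ratPlusSymbol_zero_lt_one (hp2 : p ≠ 2) (hf0 : IsNewform0 f) (hQ : coeffField f = ⊥) (hpN : ¬ p ∣ N)
    (hap : cuspCoeff f p = ((0 : ℤ) : ℂ))
    (hH1 : ∀ a : ℤ, IsCoprime a (p : ℤ) → ‖((ratPlusSymbol f ((a : ℚ) / (p : ℚ) ^ 1) : ℚ) : ℚ_[p])‖ < 1) :
    ‖((ratPlusSymbol f 0 : ℚ) : ℚ_[p])‖ < 1 := by
  have hp : p.Prime := Fact.out
  haveI : NeZero p := ⟨hp.ne_zero⟩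
  have hrat : ∀ r : ℚ, (ratPlusSymbol f r : ℝ) = normalizedPlusSymbol f r :=
    fun r ↦ ratCast_ratPlusSymbol_holds hf0 hQ r
  have hH := intCast_mul_ratPlusSymbol p hf0 hp hpN hap hrat 0
  rw [Int.cast_zero, zero_mul, mul_zero, ← Finset.add_sum_erase _ _ (Finset.mem_univ (0 : Fin p))] at hH
  simp only [Fin.val_zero, CharP.cast_eq_zero, add_zero, zero_div] at hH
  -- `2[0]⁺ = −Σ_{j≠0} [j/p]⁺`
  have h2 : (2 : ℚ) * ratPlusSymbol f 0 =
      -∑ j ∈ (Finset.univ : Finset (Fin p)).erase 0, ratPlusSymbol f ((0 + (j : ℚ)) / p) := by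
    linarith
  have hnorm : ‖(((2 : ℚ) * ratPlusSymbol f 0 : ℚ) : ℚ_[p])‖ < 1 := by
    rw [h2]
    push_cast
    rw [norm_neg]
    refine Finset.sum_induction _ (fun x : ℚ_[p] ↦ ‖x‖ < 1) (fun _ _ ↦ padic_norm_add_lt_one) (by simp) fun j hj ↦ ?_
    have hj0 : j ≠ 0 := Finset.ne_of_mem_erase hj
    have hjp : ¬ p ∣ (j : ℕ) := fun h ↦ hj0 (Fin.ext (by
      rw [Fin.val_zero]
      exact Nat.eq_zero_of_dvd_of_lt h j.isLt))
    have hcop : IsCoprime (((j : ℕ) : ℤ)) (p : ℤ) := by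
      rw [Int.isCoprime_iff_gcd_eq_one]
      have : Nat.Coprime (j : ℕ) p := (Nat.coprime_comm.mp ((hp.coprime_iff_not_dvd).mpr hjp))
      exact_mod_cast this
    have h := hH1 ((j : ℕ) : ℤ) hcop
    have heq : (((j : ℕ) : ℤ) : ℚ) / (p : ℚ) ^ 1 = (0 + ((j : ℕ) : ℚ)) / p := by push_cast; ring
    rw [heq] at h
    exact_mod_cast h
  have htwo : ‖((2 : ℚ) : ℚ_[p])‖ = 1 := by
    rw [show ((2 : ℚ) : ℚ_[p]) = ((2 : ℕ) : ℚ_[p]) by norm_cast, Padic.norm_natCast_eq_one_iff]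
    exact (Nat.coprime_primes hp Nat.prime_two).mpr hp2
  push_cast at hnorm
  rw [norm_mul] at hnorm
  have : ‖(2 : ℚ_[p])‖ = 1 := by exact_mod_cast htwo
  rwa [this, one_mul] at hnorm

end Summit.BirchSwinnertonDyer.BirchSwinnertonDyer.Theorems.SmallImageHeckePrimeMu

end
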